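import Literature.Topology.FourManifolds.LatticeFormsOrthogonalGroupGenerationOriented
import Literature.Topology.FourManifolds.LatticeFormsStableSpecialOrthogonalWords
import HarnessLib

/-!
# `SO⁺(U ⊕ U₁)` is generated by the four transvections `t(e,e₁)`, `t(e,f₁)`, `t(f,e₁)`, `t(f,f₁)`; `O⁺(U) = {1, σ}`,
# `SO⁺(U) = {1}` (Gritsenko–Hulek–Sankaran, *J. Algebra* 322 (2009) §3.2, Lemma 3.2)

Trunk T-4MAN vocabulary. Sequel of `LatticeFormsOrthogonalGroupGenerationOriented.lean` (row g48-#10: every isometry of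
`Q ⊕ H` is `(ψ ⊕ 1) · A_a · w` with `A_a · w ∈ S̃O⁺` an admissible word in the Eichler transvections `E(y,b,q)`,
`E(x,b,q)`, `b ⊥ x, y`, and `φ ∈ O⁺ ⟺ ψ ∈ O⁺`, `det φ = det ψ`), `LatticeFormsWallGenerators.lean` (`O(H) = {±1, ±σ}`,
`hyperbolicForm_isometryEquiv_eq`), `LatticeFormsOrientationCharacter.lean` (`O⁺(L) = IsOrientationPreserving`, the
character property, `σ_r ∈ O⁺ ⟺ r² = −2`) and `LatticeFormsStableSpecialOrthogonalWords.lean` (words in `S̃O⁺`-elements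
are in `S̃O⁺`). Written for lane `lit-hodgefound` (Track 2 foundations; prover seat `lit-hodgefound-p18`, gen 49, row g49-#4).
THEOREMS ONLY — no definition, no named fact, no instance, no notation.

## Source, verbatim (held text `paper:arxiv-0810.1614`, §1 p. 3 and §3.2 p. 6)

* §1: "`sn_K(g) = (−(v₁,v₁)/2)⋯(−(v_m,v_m)/2)(K^×)²` […] `O⁺(L) = O(L) ∩ ker sn_ℝ` […] We also use the notation
  `SO⁺(L) = O⁺(L) ∩ SO(L)`".
* §3.2: "Suppose `L = U ⊕ U₁ ⊕ L₀`, where `U = ℤe ⊕ ℤf` and `U₁ = ℤe₁ ⊕ ℤf₁` are two integral hyperbolic planes. […] It is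
  easy to see, using only the elementary divisor theorem, that `SL₂(ℤ) × SL₂(ℤ)/{±(1₂,1₂)} ≅ SO⁺(U ⊕ U₁)`. […]
  **Lemma 3.2.** `SO⁺(U ⊕ U₁)` is generated by the four transvections `t(e,e₁)`, `t(e,f₁)`, `t(f,e₁)` and `t(f,f₁)`. For
  any `v ∈ U ⊕ U₁` there exists `g ∈ SO⁺(U ⊕ U₁)` such that `g(v) ∈ U₁`."

## Contents (all proved) and reading notes

The model is `H ⊕ H = hyperbolicForm.prod hyperbolicForm` on `(Fin 2 → ℤ) × (Fin 2 → ℤ)` with `U = 0 ⊕ H`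
(`x = hypX = (0,e₀)`, `y = hypY = (0,e₁)`, Kirby's convention of the predecessor files) and `U₁ = H ⊕ 0`
(`x₁ = (e₀,0)`, `y₁ = (e₁,0)`); GHS's `t(f,a) = E(x,a,·)`, `t(e,a) = E(y,a,·)`. The second assertion of Lemma 3.2 is the
tree's `exists_uGens_ortho` (`LatticeFormsEichlerCriterion.lean`); this file proves the first.

* §1 **The hyperbolic plane**: `σ = hyperbolicSwap` is the reflection in the `(−2)`-vector `e₀ − e₁` and `−σ` the
  reflection in the `(+2)`-vector `e₀ + e₁`; hence `σ ∈ O⁺(H)`, `−σ ∉ O⁺(H)`, `−1 = σ(−σ) ∉ O⁺(H)`, `det σ = det(−σ) = −1`,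
  `det(−1) = 1`, and with `O(H) = {±1, ±σ}`: **`O⁺(H) = {1, σ}`** (`hyperbolicForm_isOrientationPreserving_iff`),
  **`SO⁺(H) = {1}`** (`hyperbolicForm_eq_refl_of_isOrientationPreserving_of_det_eq_one`).
* §2 **`SO⁺(H ⊕ H) = E_U(U₁)`**: every `φ ∈ SO⁺(H ⊕ H)` (`φ ∈ O⁺`, `det φ = 1`) is an admissible word
  (`exists_uGens_eq_of_isOrientationPreserving_of_det_eq_one`: in `φ = (ψ ⊕ 1) · A_a · w`, `ψ ∈ SO⁺(H) = {1}` and `A_a` is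
  itself the admissible letter `E(y,(a,0))`), and admissible words lie in `S̃O⁺ ⊆ SO⁺`
  (`isOrientationPreserving_and_det_eq_one_iff_exists_uGens`).
* §3 **The four generators**: an admissible letter `E(y,(b,0),q)` of `H ⊕ H` has `b = m e₀ + n e₁`, `q = mn`, and
  `E(y,(b,0),mn) = E(y,(e₀,0),0)^m E(y,(e₁,0),0)^n` ((t3)); so every `φ ∈ SO⁺(H ⊕ H)` is a word in the four transvections
  `E(y,(e₀,0),0)`, `E(y,(e₁,0),0)`, `E(x,(e₀,0),0)`, `E(x,(e₁,0),0)` (= Kirby's `A_{e₀}, A_{e₁}, A'_{e₀}, A'_{e₁}`) and their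
  inverses (`isWordIn_fourTransvections_of_isOrientationPreserving_of_det_eq_one`), and conversely such words lie in
  `SO⁺(H ⊕ H)` (`isWordIn_fourTransvections_iff`) — "**`SO⁺(U ⊕ U₁)` is generated by the four transvections**".
-/

noncomputable section

open Module
open LinearMap (BilinForm)
open LinearMap.BilinForm
open LinearMap.BilinForm (IsometryEquiv)
open Literature.LinearAlgebra.QuadraticForm

namespace Literature.Topology.FourManifolds

/-! ### §1 The hyperbolic plane: `O⁺(H) = {1, σ}`, `SO⁺(H) = {1}` -/

section Plane

/-- `(e₀ − e₁)² = −2` in `H`. [cite: GritsenkoHulekSankaran2009, §3.3 Prop. 3.3 (iv) (σ_{e−f})] -/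
theorem hyperbolicForm_apply_oneNegOne : hyperbolicForm ![1, -1] ![1, -1] = -1 + -1 := by
  rw [hyperbolicForm_apply]
  simp

/-- `(e₀ + e₁)² = 2` in `H`. [cite: GritsenkoHulekSankaran2009, §3.1 (t7) (σ_{e + f})] -/
theorem hyperbolicForm_apply_oneOne : hyperbolicForm ![1, 1] ![1, 1] = 1 + 1 := by
  rw [hyperbolicForm_apply]
  simp

/-- **`σ = σ_{e₀−e₁}`**: the swap of the hyperbolic plane is the reflection in the `(−2)`-vector `e₀ − e₁`.
[cite: GritsenkoHulekSankaran2009, §3.3 Prop. 3.3 (iv) (σ_{e−f})] -/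
theorem hyperbolicSwap_eq_normTwoReflectionEquiv :
    hyperbolicSwap = normTwoReflectionEquiv isSymm_hyperbolicForm ![1, -1] (-1) hyperbolicForm_apply_oneNegOne
      (by norm_num) := by
  refine DFunLike.ext _ _ fun v ↦ ?_
  rw [hyperbolicSwap_apply, normTwoReflectionEquiv_apply, hyperbolicForm_apply]
  ext i
  fin_cases i <;> simp

/-- **`−σ = σ_{e₀+e₁}`**: minus the swap is the reflection in the `(+2)`-vector `e₀ + e₁`.
[cite: GritsenkoHulekSankaran2009, §3.1 (t7) (σ_{e+f})] -/
theorem hyperbolicSwap_trans_neg_eq_normTwoReflectionEquiv :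
    hyperbolicSwap.trans (LinearMap.BilinForm.IsometryEquiv.neg hyperbolicForm) =
      normTwoReflectionEquiv isSymm_hyperbolicForm ![1, 1] 1 hyperbolicForm_apply_oneOne (by norm_num) := by
  refine DFunLike.ext _ _ fun v ↦ ?_
  rw [LinearMap.BilinForm.IsometryEquiv.trans_apply, LinearMap.BilinForm.IsometryEquiv.neg_apply, hyperbolicSwap_apply,
    normTwoReflectionEquiv_apply, hyperbolicForm_apply]
  ext i
  fin_cases i <;> simp

/-- **`σ ∈ O⁺(H)`** (`sn(σ_{e₀−e₁}) = −(−2)/2 = 1`). [cite: GritsenkoHulekSankaran2009, §1 ("O⁺(L) = O(L) ∩ ker sn_ℝ")] -/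
theorem isOrientationPreserving_hyperbolicSwap : hyperbolicSwap.IsOrientationPreserving := by
  rw [hyperbolicSwap_eq_normTwoReflectionEquiv]
  exact (isOrientationPreserving_normTwoReflectionEquiv_iff hyperbolicForm isSymm_hyperbolicForm
    isUnimodular_hyperbolicForm_holds.nondegenerate _ (-1) _ _).2 rfl

/-- **`−σ ∉ O⁺(H)`** (`sn(σ_{e₀+e₁}) = −1`). [cite: GritsenkoHulekSankaran2009, §1 ("O⁺(L) = O(L) ∩ ker sn_ℝ")] -/
theorem not_isOrientationPreserving_hyperbolicSwap_trans_neg :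
    ¬ (hyperbolicSwap.trans (LinearMap.BilinForm.IsometryEquiv.neg hyperbolicForm)).IsOrientationPreserving := by
  rw [hyperbolicSwap_trans_neg_eq_normTwoReflectionEquiv, isOrientationPreserving_normTwoReflectionEquiv_iff hyperbolicForm
    isSymm_hyperbolicForm isUnimodular_hyperbolicForm_holds.nondegenerate]
  norm_num

/-- **`−1 ∉ O⁺(H)`**: `−1 = σ · (−σ)` with exactly one factor outside `O⁺` (equivalently `n₊(H) = 1` is odd).
[cite: GritsenkoHulekSankaran2009, §1 ("O⁺(L) = O(L) ∩ ker sn_ℝ")] -/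
theorem not_isOrientationPreserving_neg_hyperbolicForm :
    ¬ (LinearMap.BilinForm.IsometryEquiv.neg hyperbolicForm).IsOrientationPreserving := by
  have h : LinearMap.BilinForm.IsometryEquiv.neg hyperbolicForm =
      hyperbolicSwap.trans (hyperbolicSwap.trans (LinearMap.BilinForm.IsometryEquiv.neg hyperbolicForm)) := by
    refine DFunLike.ext _ _ fun v ↦ ?_
    rw [LinearMap.BilinForm.IsometryEquiv.trans_apply, LinearMap.BilinForm.IsometryEquiv.trans_apply,
      LinearMap.BilinForm.IsometryEquiv.neg_apply, LinearMap.BilinForm.IsometryEquiv.neg_apply, hyperbolicSwap_apply,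
      hyperbolicSwap_apply]
    ext i
    fin_cases i <;> simp
  rw [h, LinearMap.BilinForm.IsometryEquiv.isOrientationPreserving_trans_iff isSymm_hyperbolicForm
    isUnimodular_hyperbolicForm_holds.nondegenerate]
  intro H
  exact not_isOrientationPreserving_hyperbolicSwap_trans_neg (H.2 isOrientationPreserving_hyperbolicSwap)

/-- **`det σ = −1`.** [cite: GritsenkoHulekSankaran2009, §3.2 (Lemma 3.2: SO⁺(U ⊕ U₁))] -/
theorem det_hyperbolicSwap :
    LinearMap.det ((hyperbolicSwap : hyperbolicForm.IsometryEquiv hyperbolicForm) : (Fin 2 → ℤ) →ₗ[ℤ] (Fin 2 → ℤ)) = -1 := by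
  rw [hyperbolicSwap_eq_normTwoReflectionEquiv]
  exact det_normTwoReflectionEquiv hyperbolicForm isSymm_hyperbolicForm _ (-1) _ _

/-- **`det(−σ) = −1`.** [cite: GritsenkoHulekSankaran2009, §3.2 (Lemma 3.2: SO⁺(U ⊕ U₁))] -/
theorem det_hyperbolicSwap_trans_neg :
    LinearMap.det ((hyperbolicSwap.trans (LinearMap.BilinForm.IsometryEquiv.neg hyperbolicForm) :
      hyperbolicForm.IsometryEquiv hyperbolicForm) : (Fin 2 → ℤ) →ₗ[ℤ] (Fin 2 → ℤ)) = -1 := by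
  rw [hyperbolicSwap_trans_neg_eq_normTwoReflectionEquiv]
  exact det_normTwoReflectionEquiv hyperbolicForm isSymm_hyperbolicForm _ 1 _ _

/-- **`det(−1_H) = 1`.** [cite: GritsenkoHulekSankaran2009, §3.2 ("SL₂(ℤ) × SL₂(ℤ)/{±(1₂,1₂)}")] -/
theorem det_neg_hyperbolicForm :
    LinearMap.det ((LinearMap.BilinForm.IsometryEquiv.neg hyperbolicForm : hyperbolicForm.IsometryEquiv hyperbolicForm) :
      (Fin 2 → ℤ) →ₗ[ℤ] (Fin 2 → ℤ)) = 1 := by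
  rw [LinearMap.BilinForm.IsometryEquiv.det_neg hyperbolicForm, Module.finrank_fin_fun]
  norm_num

/-- **`O⁺(H) = {1, σ}`.** [cite: GritsenkoHulekSankaran2009, §1 ("O⁺(L) = O(L) ∩ ker sn_ℝ") and §3.2] -/
theorem hyperbolicForm_isOrientationPreserving_iff (ψ : hyperbolicForm.IsometryEquiv hyperbolicForm) :
    ψ.IsOrientationPreserving ↔ ψ = LinearMap.BilinForm.IsometryEquiv.refl _ ∨ ψ = hyperbolicSwap := by
  constructor
  · intro h
    rcases hyperbolicForm_isometryEquiv_eq ψ with rfl | rfl | rfl | rfl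
    · exact Or.inl rfl
    · exact (not_isOrientationPreserving_neg_hyperbolicForm h).elim
    · exact Or.inr rfl
    · exact (not_isOrientationPreserving_hyperbolicSwap_trans_neg h).elim
  · rintro (rfl | rfl)
    · exact LinearMap.BilinForm.IsometryEquiv.IsOrientationPreserving.refl
    · exact isOrientationPreserving_hyperbolicSwap

/-- **`SO⁺(H) = {1}`**: an isometry of the hyperbolic plane in `O⁺` with determinant `1` is the identity.
[cite: GritsenkoHulekSankaran2009, §3.2 ("SL₂(ℤ) × SL₂(ℤ)/{±(1₂,1₂)} ≅ SO⁺(U ⊕ U₁)")] -/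
theorem hyperbolicForm_eq_refl_of_isOrientationPreserving_of_det_eq_one (ψ : hyperbolicForm.IsometryEquiv hyperbolicForm)
    (h₁ : ψ.IsOrientationPreserving) (h₂ : LinearMap.det (ψ : (Fin 2 → ℤ) →ₗ[ℤ] (Fin 2 → ℤ)) = 1) :
    ψ = LinearMap.BilinForm.IsometryEquiv.refl _ := by
  rcases (hyperbolicForm_isOrientationPreserving_iff ψ).1 h₁ with rfl | rfl
  · rfl
  · rw [det_hyperbolicSwap] at h₂
    norm_num at h₂

end Plane

/-! ### §2 `SO⁺(H ⊕ H) = E_U(U₁)`: every element is an admissible word -/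

section TwoPlanes

/-- `x₁ = e₀` is isotropic in `H`. [cite: GritsenkoHulekSankaran2009, §3.2 ("U₁ = ℤe₁ ⊕ ℤf₁")] -/
theorem hyperbolicPlane_apply_e₀_e₀ :
    hyperbolicForm (Pi.single 0 1 : Fin 2 → ℤ) (Pi.single 0 1) = 0 + 0 := by
  rw [hyperbolicForm_apply]
  simp

/-- `y₁ = e₁` is isotropic in `H`. [cite: GritsenkoHulekSankaran2009, §3.2 ("U₁ = ℤe₁ ⊕ ℤf₁")] -/
theorem hyperbolicPlane_apply_e₁_e₁ :
    hyperbolicForm (Pi.single 1 1 : Fin 2 → ℤ) (Pi.single 1 1) = 0 + 0 := by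
  rw [hyperbolicForm_apply]
  simp

/-- `H ⊕ H` is non-degenerate. [cite: GritsenkoHulekSankaran2009, §3.2] -/
theorem nondegenerate_hyperbolicForm_prod_hyperbolicForm : (hyperbolicForm.prod hyperbolicForm).Nondegenerate :=
  isUnimodular_hyperbolicForm_holds.nondegenerate.prod isUnimodular_hyperbolicForm_holds.nondegenerate

/-- **Lemma 3.2, first assertion (`SO⁺(U ⊕ U₁) ⊆ E_U(U₁)`)**: every isometry of `H ⊕ H` preserving the orientation and of
determinant `1` is an admissible word in the transvections `E(y,(b,0),q)`, `E(x,(b,0),q)`, `b ∈ U₁ = H`. Proof: in the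
factorisation `φ = (ψ ⊕ 1) · A_a · w` (Prop. 3.3 (iii)) the factor `A_a · w` lies in `S̃O⁺`, so `ψ ∈ SO⁺(H) = {1}`
(§1), and `A_a = E(y,(a,0),q)` is itself an admissible letter. [cite: GritsenkoHulekSankaran2009, §3.2 Lemma 3.2] -/
theorem exists_uGens_eq_of_isOrientationPreserving_of_det_eq_one
    (φ : (hyperbolicForm.prod hyperbolicForm).IsometryEquiv (hyperbolicForm.prod hyperbolicForm))
    (h₁ : φ.IsOrientationPreserving)
    (h₂ : LinearMap.det (φ : (Fin 2 → ℤ) × (Fin 2 → ℤ) →ₗ[ℤ] (Fin 2 → ℤ) × (Fin 2 → ℤ)) = 1) :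
    ∃ l : List (UGen ((Fin 2 → ℤ) × (Fin 2 → ℤ))),
      (∀ g ∈ l, g.IsAdmissible (hyperbolicForm.prod hyperbolicForm) hypX hypY) ∧
      ∀ v, φ v = UGen.eval (hyperbolicForm.prod hyperbolicForm) hypX hypY l v := by
  have hQ : hyperbolicForm.IsSymm := isSymm_hyperbolicForm
  have hB : (hyperbolicForm.prod hyperbolicForm).IsSymm := hQ.prod isSymm_hyperbolicForm
  have hndQ : hyperbolicForm.Nondegenerate := isUnimodular_hyperbolicForm_holds.nondegenerate
  have hnd := nondegenerate_hyperbolicForm_prod_hyperbolicForm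
  obtain ⟨l, hl, a, q, hq, ψ, hφ⟩ := exists_eq_prodCongr_trans_transvectionAEquiv_trans_evalEquiv hQ isEven_hyperbolicForm
    (Eq.trans hyperbolicPlane_apply_e₀_e₀ (add_zero 0))
    (Eq.trans hyperbolicPlane_apply_e₁_e₁ (add_zero 0)) (by rw [hyperbolicForm_apply]; simp) φ
  set ρ := (transvectionAEquiv hQ a q hq).trans (UGen.evalEquiv hB (prod_hyperbolic_hypX_hypX hyperbolicForm)
    (prod_hyperbolic_hypY_hypY hyperbolicForm) l hl) with hρ
  have hφ' : φ = (LinearMap.BilinForm.IsometryEquiv.prodCongr ψ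
      (LinearMap.BilinForm.IsometryEquiv.refl hyperbolicForm)).trans ρ := by
    rw [hφ]
    rfl
  have hρS := mem_stableSpecialOrthogonal_trans hB hnd (transvectionAEquiv_mem_stableSpecialOrthogonal hQ hnd a q hq)
    (UGen.evalEquiv_mem_stableSpecialOrthogonal hB hnd (prod_hyperbolic_hypX_hypX hyperbolicForm)
      (prod_hyperbolic_hypY_hypY hyperbolicForm) l hl)
  have hψ₁ : ψ.IsOrientationPreserving :=
    (isOrientationPreserving_iff_of_eq_prodCongr_refl_trans hQ hndQ hnd hφ' hρS.2.1).1 h₁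
  have hψ₂ : LinearMap.det (ψ : (Fin 2 → ℤ) →ₗ[ℤ] (Fin 2 → ℤ)) = 1 := by
    rw [← det_eq_of_eq_prodCongr_refl_trans hφ' hρS.2.2]
    exact h₂
  have hψ := hyperbolicForm_eq_refl_of_isOrientationPreserving_of_det_eq_one ψ hψ₁ hψ₂
  refine ⟨l ++ [UGen.atY ((a, 0)) q], fun g hg ↦ ?_, fun v ↦ ?_⟩
  · rcases List.mem_append.1 hg with hg | hg
    · exact hl g hg
    · rw [List.mem_singleton.1 hg]
      exact ⟨prod_hyperbolic_hypX_inl hyperbolicForm a, prod_hyperbolic_hypY_inl hyperbolicForm a,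
        by rw [prod_hyperbolic_inl_inl, hq]⟩
  · rw [hφ', hψ, UGen.eval_append, LinearMap.comp_apply, UGen.eval_cons, UGen.eval_nil, LinearMap.comp_id,
      LinearMap.BilinForm.IsometryEquiv.trans_apply, hρ, LinearMap.BilinForm.IsometryEquiv.trans_apply,
      UGen.evalEquiv_apply, transvectionAEquiv_apply]
    rfl

/-- **`SO⁺(H ⊕ H) = E_U(U₁)`**: `φ ∈ O⁺(H ⊕ H)` with `det φ = 1` iff `φ` is an admissible word (admissible words lie in
`S̃O⁺`, row g48-#10 §1; on the unimodular `H ⊕ H` the tilde is vacuous).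
[cite: GritsenkoHulekSankaran2009, §3.2 Lemma 3.2 and §3.1 (8)] -/
theorem isOrientationPreserving_and_det_eq_one_iff_exists_uGens
    (φ : (hyperbolicForm.prod hyperbolicForm).IsometryEquiv (hyperbolicForm.prod hyperbolicForm)) :
    (φ.IsOrientationPreserving ∧
        LinearMap.det (φ : (Fin 2 → ℤ) × (Fin 2 → ℤ) →ₗ[ℤ] (Fin 2 → ℤ) × (Fin 2 → ℤ)) = 1) ↔
      ∃ (l : List (UGen ((Fin 2 → ℤ) × (Fin 2 → ℤ))))
        (hl : ∀ g ∈ l, g.IsAdmissible (hyperbolicForm.prod hyperbolicForm) hypX hypY),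
        φ = UGen.evalEquiv (isSymm_hyperbolicForm.prod isSymm_hyperbolicForm) (prod_hyperbolic_hypX_hypX hyperbolicForm)
          (prod_hyperbolic_hypY_hypY hyperbolicForm) l hl := by
  constructor
  · rintro ⟨h₁, h₂⟩
    obtain ⟨l, hl, hφ⟩ := exists_uGens_eq_of_isOrientationPreserving_of_det_eq_one φ h₁ h₂
    exact ⟨l, hl, DFunLike.ext _ _ fun v ↦ by rw [hφ, UGen.evalEquiv_apply]⟩
  · rintro ⟨l, hl, rfl⟩
    exact (UGen.evalEquiv_mem_stableSpecialOrthogonal (isSymm_hyperbolicForm.prod isSymm_hyperbolicForm)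
      nondegenerate_hyperbolicForm_prod_hyperbolicForm (prod_hyperbolic_hypX_hypX hyperbolicForm)
      (prod_hyperbolic_hypY_hypY hyperbolicForm) l hl).2

end TwoPlanes

/-! ### §3 The four transvections `t(e,e₁)`, `t(e,f₁)`, `t(f,e₁)`, `t(f,f₁)` -/

section Generators

variable {W : Type*} [AddCommGroup W] {B : BilinForm ℤ W}

/-- **`t(e, c a) = t(e,a)^c`** for `a ⊥ e` isotropic: `E(e, c a, 0)` is a word in `E(e, a, 0)` and its inverse ((t3)
`t(e,a) t(e,b) = t(e,a+b)`, `t(e,a)⁻¹ = t(e,−a)`). [cite: GritsenkoHulekSankaran2009, §3.1 (t3) and §3.2 Lemma 3.2] -/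
theorem isWordIn_eichlerTransvection_zsmul (hB : B.IsSymm) {e a : W} (he : B e e = 0) (hea : B e a = 0)
    (haa : B a a = 0 + 0) (c : ℤ) (hca : B e (c • a) = 0) (hcc : B (c • a) (c • a) = 0 + 0) :
    IsWordIn {LinearMap.BilinForm.IsometryEquiv.eichlerTransvection B hB e a 0 he hea haa}
      (LinearMap.BilinForm.IsometryEquiv.eichlerTransvection B hB e (c • a) 0 he hca hcc) := by
  have hgen : LinearMap.BilinForm.IsometryEquiv.eichlerTransvection B hB e a 0 he hea haa ∈
      ({LinearMap.BilinForm.IsometryEquiv.eichlerTransvection B hB e a 0 he hea haa} :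
        Set (B.IsometryEquiv B)) := Set.mem_singleton _
  have haa0 : B a a = 0 := by rw [haa, add_zero]
  revert hca hcc
  induction c using Int.induction_on with
  | zero =>
    intro hca hcc
    refine IsWordIn.refl.congr fun v ↦ ?_
    rw [LinearMap.BilinForm.IsometryEquiv.refl_apply, LinearMap.BilinForm.IsometryEquiv.eichlerTransvection_apply,
      zero_smul, LinearMap.BilinForm.eichlerTransvection_zero, LinearMap.id_apply]
  | succ n ih =>
    intro hca hcc
    have hna : B e ((n : ℤ) • a) = 0 := by rw [map_smul, hea, smul_zero]
    have hnn : B ((n : ℤ) • a) ((n : ℤ) • a) = 0 + 0 := by simp [haa0]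
    have key := LinearMap.BilinForm.eichlerTransvection_comp B hB he hea hna 0 0
    rw [show (0 : ℤ) + 0 + B a ((n : ℤ) • a) = 0 by simp [haa0],
      show a + (n : ℤ) • a = ((n : ℤ) + 1) • a by rw [add_smul, one_smul, add_comm]] at key
    refine ((ih hna hnn).trans (IsWordIn.of_mem hgen)).congr fun v ↦ ?_
    rw [LinearMap.BilinForm.IsometryEquiv.trans_apply, LinearMap.BilinForm.IsometryEquiv.eichlerTransvection_apply,
      LinearMap.BilinForm.IsometryEquiv.eichlerTransvection_apply,
      LinearMap.BilinForm.IsometryEquiv.eichlerTransvection_apply, ← LinearMap.comp_apply, key]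
  | pred n ih =>
    intro hca hcc
    have hna : B e ((-(n : ℤ)) • a) = 0 := by rw [map_smul, hea, smul_zero]
    have hnn : B ((-(n : ℤ)) • a) ((-(n : ℤ)) • a) = 0 + 0 := by simp [haa0]
    have hea' : B e (-a) = 0 := by rw [map_neg, hea, neg_zero]
    have key := LinearMap.BilinForm.eichlerTransvection_comp B hB he hea' hna 0 0
    rw [show (0 : ℤ) + 0 + B (-a) ((-(n : ℤ)) • a) = 0 by simp [haa0],
      show -a + (-(n : ℤ)) • a = (-(n : ℤ) - 1) • a by rw [sub_smul, one_smul, neg_add_eq_sub]] at key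
    refine ((ih hna hnn).trans (IsWordIn.of_mem hgen).symm).congr fun v ↦ ?_
    rw [LinearMap.BilinForm.IsometryEquiv.trans_apply, LinearMap.BilinForm.IsometryEquiv.eichlerTransvection_symm_apply,
      LinearMap.BilinForm.IsometryEquiv.eichlerTransvection_apply,
      LinearMap.BilinForm.IsometryEquiv.eichlerTransvection_apply, ← LinearMap.comp_apply, key]

/-- **`t(e, m x₁ + n y₁) = t(e, x₁)^m t(e, y₁)^n`**: for isotropic `x₁, y₁ ⊥ e` with `(x₁, y₁) = 1` the transvection
`E(e, m x₁ + n y₁, mn)` is a word in `E(e,x₁,0)`, `E(e,y₁,0)` and their inverses ((t3)).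
[cite: GritsenkoHulekSankaran2009, §3.1 (t3) and §3.2 Lemma 3.2] -/
theorem isWordIn_eichlerTransvection_add (hB : B.IsSymm) {e x₁ y₁ : W} (he : B e e = 0) (hex₁ : B e x₁ = 0)
    (hey₁ : B e y₁ = 0) (hx₁ : B x₁ x₁ = 0 + 0) (hy₁ : B y₁ y₁ = 0 + 0) (hx₁y₁ : B x₁ y₁ = 1) (m n : ℤ)
    (hea : B e (m • x₁ + n • y₁) = 0) (haa : B (m • x₁ + n • y₁) (m • x₁ + n • y₁) = m * n + m * n) :
    IsWordIn {LinearMap.BilinForm.IsometryEquiv.eichlerTransvection B hB e x₁ 0 he hex₁ hx₁,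
        LinearMap.BilinForm.IsometryEquiv.eichlerTransvection B hB e y₁ 0 he hey₁ hy₁}
      (LinearMap.BilinForm.IsometryEquiv.eichlerTransvection B hB e (m • x₁ + n • y₁) (m * n) he hea haa) := by
  have hmx : B e (m • x₁) = 0 := by rw [map_smul, hex₁, smul_zero]
  have hny : B e (n • y₁) = 0 := by rw [map_smul, hey₁, smul_zero]
  have hx₁0 : B x₁ x₁ = 0 := by rw [hx₁, add_zero]
  have hy₁0 : B y₁ y₁ = 0 := by rw [hy₁, add_zero]
  have hmm : B (m • x₁) (m • x₁) = 0 + 0 := by simp [hx₁0]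
  have hnn : B (n • y₁) (n • y₁) = 0 + 0 := by simp [hy₁0]
  have hm := isWordIn_eichlerTransvection_zsmul hB he hex₁ hx₁ m hmx hmm
  have hn := isWordIn_eichlerTransvection_zsmul hB he hey₁ hy₁ n hny hnn
  have key := LinearMap.BilinForm.eichlerTransvection_comp B hB he hmx hny 0 0
  rw [show (0 : ℤ) + 0 + B (m • x₁) (n • y₁) = m * n by simp [hx₁y₁, mul_comm]] at key
  refine ((hn.mono fun s hs ↦ Or.inr hs).trans (hm.mono fun s hs ↦ Or.inl hs)).congr fun v ↦ ?_
  rw [LinearMap.BilinForm.IsometryEquiv.trans_apply, LinearMap.BilinForm.IsometryEquiv.eichlerTransvection_apply,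
    LinearMap.BilinForm.IsometryEquiv.eichlerTransvection_apply,
    LinearMap.BilinForm.IsometryEquiv.eichlerTransvection_apply, ← LinearMap.comp_apply, key]

/-- A vector `b ∈ H` is `b₀ e₀ + b₁ e₁`. [cite: GritsenkoHulekSankaran2009, §3.2 ("U₁ = ℤe₁ ⊕ ℤf₁")] -/
theorem hyperbolicPlane_eq_smul_single_add_smul_single (b : Fin 2 → ℤ) :
    b = b 0 • (Pi.single 0 1 : Fin 2 → ℤ) + b 1 • (Pi.single 1 1 : Fin 2 → ℤ) := by
  ext i
  fin_cases i <;> simp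

/-- **An admissible letter `E(y,(b,0),q)` of `H ⊕ H` is a word in `A_{e₀} = E(y,(e₀,0),0)` and `A_{e₁} = E(y,(e₁,0),0)`**
(`b = b₀ e₀ + b₁ e₁`, `q = b₀ b₁`). [cite: GritsenkoHulekSankaran2009, §3.2 Lemma 3.2] -/
theorem isWordIn_toIsometryEquiv_atY (b : (Fin 2 → ℤ) × (Fin 2 → ℤ)) (q : ℤ)
    (hg : (UGen.atY b q).IsAdmissible (hyperbolicForm.prod hyperbolicForm) hypX hypY) :
    IsWordIn {transvectionAEquiv isSymm_hyperbolicForm (Pi.single 0 1) 0 hyperbolicPlane_apply_e₀_e₀,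
        transvectionAEquiv isSymm_hyperbolicForm (Pi.single 1 1) 0 hyperbolicPlane_apply_e₁_e₁}
      (UGen.toIsometryEquiv (isSymm_hyperbolicForm.prod isSymm_hyperbolicForm) (prod_hyperbolic_hypX_hypX hyperbolicForm)
        (prod_hyperbolic_hypY_hypY hyperbolicForm) (UGen.atY b q) hg) := by
  have hB : (hyperbolicForm.prod hyperbolicForm).IsSymm := isSymm_hyperbolicForm.prod isSymm_hyperbolicForm
  obtain ⟨hx, hy, hq⟩ := hg
  have hb := eq_inl_of_ortho hx hy
  have hb' : b = (b.1 0 • ((Pi.single 0 1 : Fin 2 → ℤ), (0 : Fin 2 → ℤ)) +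
      b.1 1 • ((Pi.single 1 1 : Fin 2 → ℤ), (0 : Fin 2 → ℤ)) : (Fin 2 → ℤ) × (Fin 2 → ℤ)) := by
    rw [hb, Prod.smul_mk, Prod.smul_mk, Prod.mk_add_mk, smul_zero, smul_zero, add_zero, ← hyperbolicPlane_eq_smul_single_add_smul_single]
  have hq' : q = b.1 0 * b.1 1 := by
    rw [hb, prod_hyperbolic_inl_inl, hyperbolicForm_apply_self] at hq
    omega
  have key := isWordIn_eichlerTransvection_add hB (e := hypY) (x₁ := ((Pi.single 0 1 : Fin 2 → ℤ), (0 : Fin 2 → ℤ)))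
    (y₁ := ((Pi.single 1 1 : Fin 2 → ℤ), (0 : Fin 2 → ℤ))) (prod_hyperbolic_hypY_hypY hyperbolicForm)
    (prod_hyperbolic_hypY_inl hyperbolicForm _) (prod_hyperbolic_hypY_inl hyperbolicForm _)
    (by rw [prod_hyperbolic_inl_inl, hyperbolicPlane_apply_e₀_e₀])
    (by rw [prod_hyperbolic_inl_inl, hyperbolicPlane_apply_e₁_e₁])
    (by rw [prod_hyperbolic_inl_inl, hyperbolicForm_apply]; simp) (b.1 0) (b.1 1)
    (by rw [← hb']; exact hy) (by rw [← hb', hq, hq'])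
  refine key.congr fun v ↦ ?_
  rw [LinearMap.BilinForm.IsometryEquiv.eichlerTransvection_apply, UGen.toIsometryEquiv_apply, ← hb', ← hq']
  rfl

/-- **An admissible letter `E(x,(b,0),q)` of `H ⊕ H` is a word in `A'_{e₀} = E(x,(e₀,0),0)` and `A'_{e₁} = E(x,(e₁,0),0)`.**
[cite: GritsenkoHulekSankaran2009, §3.2 Lemma 3.2] -/
theorem isWordIn_toIsometryEquiv_atX (b : (Fin 2 → ℤ) × (Fin 2 → ℤ)) (q : ℤ)
    (hg : (UGen.atX b q).IsAdmissible (hyperbolicForm.prod hyperbolicForm) hypX hypY) :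
    IsWordIn {transvectionA'Equiv isSymm_hyperbolicForm (Pi.single 0 1) 0 hyperbolicPlane_apply_e₀_e₀,
        transvectionA'Equiv isSymm_hyperbolicForm (Pi.single 1 1) 0 hyperbolicPlane_apply_e₁_e₁}
      (UGen.toIsometryEquiv (isSymm_hyperbolicForm.prod isSymm_hyperbolicForm) (prod_hyperbolic_hypX_hypX hyperbolicForm)
        (prod_hyperbolic_hypY_hypY hyperbolicForm) (UGen.atX b q) hg) := by
  have hB : (hyperbolicForm.prod hyperbolicForm).IsSymm := isSymm_hyperbolicForm.prod isSymm_hyperbolicForm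
  obtain ⟨hx, hy, hq⟩ := hg
  have hb := eq_inl_of_ortho hx hy
  have hb' : b = (b.1 0 • ((Pi.single 0 1 : Fin 2 → ℤ), (0 : Fin 2 → ℤ)) +
      b.1 1 • ((Pi.single 1 1 : Fin 2 → ℤ), (0 : Fin 2 → ℤ)) : (Fin 2 → ℤ) × (Fin 2 → ℤ)) := by
    rw [hb, Prod.smul_mk, Prod.smul_mk, Prod.mk_add_mk, smul_zero, smul_zero, add_zero, ← hyperbolicPlane_eq_smul_single_add_smul_single]
  have hq' : q = b.1 0 * b.1 1 := by
    rw [hb, prod_hyperbolic_inl_inl, hyperbolicForm_apply_self] at hq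
    omega
  have key := isWordIn_eichlerTransvection_add hB (e := hypX) (x₁ := ((Pi.single 0 1 : Fin 2 → ℤ), (0 : Fin 2 → ℤ)))
    (y₁ := ((Pi.single 1 1 : Fin 2 → ℤ), (0 : Fin 2 → ℤ))) (prod_hyperbolic_hypX_hypX hyperbolicForm)
    (prod_hyperbolic_hypX_inl hyperbolicForm _) (prod_hyperbolic_hypX_inl hyperbolicForm _)
    (by rw [prod_hyperbolic_inl_inl, hyperbolicPlane_apply_e₀_e₀])
    (by rw [prod_hyperbolic_inl_inl, hyperbolicPlane_apply_e₁_e₁])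
    (by rw [prod_hyperbolic_inl_inl, hyperbolicForm_apply]; simp) (b.1 0) (b.1 1)
    (by rw [← hb']; exact hx) (by rw [← hb', hq, hq'])
  refine key.congr fun v ↦ ?_
  rw [LinearMap.BilinForm.IsometryEquiv.eichlerTransvection_apply, UGen.toIsometryEquiv_apply, ← hb', ← hq']
  rfl

/-- **Admissible words of `H ⊕ H` are words in the four transvections** `A_{e₀}, A_{e₁}, A'_{e₀}, A'_{e₁}`.
[cite: GritsenkoHulekSankaran2009, §3.2 Lemma 3.2] -/
theorem isWordIn_fourTransvections_evalEquiv (l : List (UGen ((Fin 2 → ℤ) × (Fin 2 → ℤ))))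
    (hl : ∀ g ∈ l, g.IsAdmissible (hyperbolicForm.prod hyperbolicForm) hypX hypY) :
    IsWordIn {transvectionAEquiv isSymm_hyperbolicForm (Pi.single 0 1) 0 hyperbolicPlane_apply_e₀_e₀,
        transvectionAEquiv isSymm_hyperbolicForm (Pi.single 1 1) 0 hyperbolicPlane_apply_e₁_e₁,
        transvectionA'Equiv isSymm_hyperbolicForm (Pi.single 0 1) 0 hyperbolicPlane_apply_e₀_e₀,
        transvectionA'Equiv isSymm_hyperbolicForm (Pi.single 1 1) 0 hyperbolicPlane_apply_e₁_e₁}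
      (UGen.evalEquiv (isSymm_hyperbolicForm.prod isSymm_hyperbolicForm) (prod_hyperbolic_hypX_hypX hyperbolicForm)
        (prod_hyperbolic_hypY_hypY hyperbolicForm) l hl) := by
  induction l with
  | nil => exact IsWordIn.refl
  | cons g l ih =>
    have h₁ := ih fun g' hg' ↦ hl g' (List.mem_cons_of_mem g hg')
    have h₂ : IsWordIn {transvectionAEquiv isSymm_hyperbolicForm (Pi.single 0 1) 0 hyperbolicPlane_apply_e₀_e₀,
        transvectionAEquiv isSymm_hyperbolicForm (Pi.single 1 1) 0 hyperbolicPlane_apply_e₁_e₁,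
        transvectionA'Equiv isSymm_hyperbolicForm (Pi.single 0 1) 0 hyperbolicPlane_apply_e₀_e₀,
        transvectionA'Equiv isSymm_hyperbolicForm (Pi.single 1 1) 0 hyperbolicPlane_apply_e₁_e₁}
        (UGen.toIsometryEquiv (isSymm_hyperbolicForm.prod isSymm_hyperbolicForm) (prod_hyperbolic_hypX_hypX hyperbolicForm)
          (prod_hyperbolic_hypY_hypY hyperbolicForm) g (hl g List.mem_cons_self)) := by
      cases g with
      | atY b q =>
        refine (isWordIn_toIsometryEquiv_atY b q (hl _ List.mem_cons_self)).mono fun s hs ↦ ?_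
        rcases hs with rfl | rfl
        · exact Or.inl rfl
        · exact Or.inr (Or.inl rfl)
      | atX b q =>
        refine (isWordIn_toIsometryEquiv_atX b q (hl _ List.mem_cons_self)).mono fun s hs ↦ ?_
        rcases hs with rfl | rfl
        · exact Or.inr (Or.inr (Or.inl rfl))
        · exact Or.inr (Or.inr (Or.inr rfl))
    exact h₁.trans h₂

/-- **Lemma 3.2: "`SO⁺(U ⊕ U₁)` is generated by the four transvections `t(e,e₁)`, `t(e,f₁)`, `t(f,e₁)` and `t(f,f₁)`"** —
every `φ ∈ SO⁺(H ⊕ H)` is a word in `A_{e₀}, A_{e₁}, A'_{e₀}, A'_{e₁}` and their inverses.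
[cite: GritsenkoHulekSankaran2009, §3.2 Lemma 3.2] -/
theorem isWordIn_fourTransvections_of_isOrientationPreserving_of_det_eq_one
    (φ : (hyperbolicForm.prod hyperbolicForm).IsometryEquiv (hyperbolicForm.prod hyperbolicForm))
    (h₁ : φ.IsOrientationPreserving)
    (h₂ : LinearMap.det (φ : (Fin 2 → ℤ) × (Fin 2 → ℤ) →ₗ[ℤ] (Fin 2 → ℤ) × (Fin 2 → ℤ)) = 1) :
    IsWordIn {transvectionAEquiv isSymm_hyperbolicForm (Pi.single 0 1) 0 hyperbolicPlane_apply_e₀_e₀,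
        transvectionAEquiv isSymm_hyperbolicForm (Pi.single 1 1) 0 hyperbolicPlane_apply_e₁_e₁,
        transvectionA'Equiv isSymm_hyperbolicForm (Pi.single 0 1) 0 hyperbolicPlane_apply_e₀_e₀,
        transvectionA'Equiv isSymm_hyperbolicForm (Pi.single 1 1) 0 hyperbolicPlane_apply_e₁_e₁} φ := by
  obtain ⟨l, hl, hφ⟩ := (isOrientationPreserving_and_det_eq_one_iff_exists_uGens φ).1 ⟨h₁, h₂⟩
  rw [hφ]
  exact isWordIn_fourTransvections_evalEquiv l hl

/-- **`SO⁺(H ⊕ H) = ⟨A_{e₀}, A_{e₁}, A'_{e₀}, A'_{e₁}⟩`** as an equivalence: the words in the four transvections are exactly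
the isometries in `O⁺` of determinant `1` (each generator is an Eichler transvection, in `S̃O⁺`).
[cite: GritsenkoHulekSankaran2009, §3.2 Lemma 3.2 and §3.1 (8)] -/
theorem isWordIn_fourTransvections_iff
    (φ : (hyperbolicForm.prod hyperbolicForm).IsometryEquiv (hyperbolicForm.prod hyperbolicForm)) :
    IsWordIn {transvectionAEquiv isSymm_hyperbolicForm (Pi.single 0 1) 0 hyperbolicPlane_apply_e₀_e₀,
        transvectionAEquiv isSymm_hyperbolicForm (Pi.single 1 1) 0 hyperbolicPlane_apply_e₁_e₁,
        transvectionA'Equiv isSymm_hyperbolicForm (Pi.single 0 1) 0 hyperbolicPlane_apply_e₀_e₀,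
        transvectionA'Equiv isSymm_hyperbolicForm (Pi.single 1 1) 0 hyperbolicPlane_apply_e₁_e₁} φ ↔
      φ.IsOrientationPreserving ∧
        LinearMap.det (φ : (Fin 2 → ℤ) × (Fin 2 → ℤ) →ₗ[ℤ] (Fin 2 → ℤ) × (Fin 2 → ℤ)) = 1 := by
  refine ⟨fun h ↦ ?_, fun h ↦ isWordIn_fourTransvections_of_isOrientationPreserving_of_det_eq_one φ h.1 h.2⟩
  have hnd := nondegenerate_hyperbolicForm_prod_hyperbolicForm
  exact (h.mem_stableSpecialOrthogonal (isSymm_hyperbolicForm.prod isSymm_hyperbolicForm) hnd fun s hs ↦ by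
    rcases hs with rfl | rfl | rfl | rfl
    · exact transvectionAEquiv_mem_stableSpecialOrthogonal isSymm_hyperbolicForm hnd _ 0 _
    · exact transvectionAEquiv_mem_stableSpecialOrthogonal isSymm_hyperbolicForm hnd _ 0 _
    · exact transvectionA'Equiv_mem_stableSpecialOrthogonal isSymm_hyperbolicForm hnd _ 0 _
    · exact transvectionA'Equiv_mem_stableSpecialOrthogonal isSymm_hyperbolicForm hnd _ 0 _).2

end Generators

end Literature.Topology.FourManifolds

end
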